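import Mathlib.Geometry.Manifold.PartitionOfUnity
import Mathlib.Analysis.Distribution.FourierMultiplier
import Literature.Analysis.FluidPDE.TaoAveragedCascadeSteps
import Literature.Analysis.FluidPDE.TaoCascadeWaveletData
import HarnessLib

/-!
# Decomposing an annular profile into finitely many ball-supported complex pieces (Tao 2016, §3.2)

T. Tao, *Finite time blowup for an averaged three-dimensional Navier–Stokes equation*,
J. Amer. Math. Soc. **29** (2016), 601–674 = arXiv:1402.0290v3 (held as `paper:arxiv-1402.0290`),
§3.2, p. 15: "By decomposing the `ψⱼ`, `j = 1, 2, 3` in (3.4) into finitely many (complex-valued)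
pieces, we may replace the basic local cascade operator with the complexified basic local cascade
operator (3.6), where each `ψⱼ : ℝ³ → ℂ³` is now a Schwartz complex vector field with Fourier
transform `ψ̂ⱼ` supported on the ball `B(ξⱼ⁰, ε₀³)` for some non-zero `ξⱼ⁰ ∈ ℝ³` with magnitude
comparable to `1`." This file carries out that decomposition, with proofs:

* `freqAnnulus ε₀` — the closed annulus `{1 - 2ε₀ ≤ |ξ| ≤ 1 + 2ε₀}` of Definition 3.1 (compact);
* `exists_annulus_partition` — a **smooth finite partition of unity on the annulus subordinate to
  balls of radius `r`** centred on the annulus (Mathlib's `SmoothPartitionOfUnity` on `ℝ³`);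
* `freqPiece χ ψ` — the Fourier-multiplier piece `𝓕⁻¹(χ ψ̂)` of a complex Schwartz field (Mathlib's
  `SchwartzMap.fourierMultiplierCLM`), with `fourier_freqPiece` (`𝓕(freqPiece χ ψ) = χ ψ̂`),
  `hasBallFourierSupport_freqPiece`, and `sum_freqPiece_eq` (the pieces of a partition of unity on
  the support of `ψ̂` sum to `ψ`);
* `exists_ball_pieces` — **every real Schwartz profile with Fourier support in the annulus is a
  finite sum of complex Schwartz fields with Fourier supports in balls `B(c_a, r)`, `c_a` in the
  annulus**, for any `r > 0` (applied with `r = ε₀³/4` in the proof of `basicCascade_of_normalised`).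

## References

* T. Tao, J. Amer. Math. Soc. 29 (2016), 601–674, arXiv:1402.0290v3, Def. 3.1, §3.2 p. 15 (3.6).
  Key `Tao2016AveragedNS`.
-/

noncomputable section

open MeasureTheory Set Filter FourierTransform Metric
open scoped ENNReal NNReal SchwartzMap Manifold ContDiff

namespace Literature.Analysis.FluidPDE.Tao2016

/-- Local notation for physical / frequency space `ℝ³`. -/
local notation "ℝ³" => EuclideanSpace ℝ (Fin 3)
/-- Local notation for the complexified range `ℂ³`. -/
local notation "ℂ³" => EuclideanSpace ℂ (Fin 3)

/-! ### The frequency annulus of Definition 3.1 -/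

/-- The closed frequency annulus `{ξ : 1 - 2ε₀ ≤ |ξ| ≤ 1 + 2ε₀}` carrying the Fourier transforms of
the profiles of a basic local cascade operator. [cite: Tao2016AveragedNS, Def. 3.1] -/
def freqAnnulus (ε₀ : ℝ) : Set ℝ³ := (fun ξ : ℝ³ => ‖ξ‖) ⁻¹' Icc (1 - 2 * ε₀) (1 + 2 * ε₀)

/-- Membership in the annulus. [cite: Tao2016AveragedNS, Def. 3.1] -/
theorem mem_freqAnnulus {ε₀ : ℝ} {ξ : ℝ³} :
    ξ ∈ freqAnnulus ε₀ ↔ 1 - 2 * ε₀ ≤ ‖ξ‖ ∧ ‖ξ‖ ≤ 1 + 2 * ε₀ := Iff.rfl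

/-- The annulus is closed. [folklore] -/
theorem isClosed_freqAnnulus (ε₀ : ℝ) : IsClosed (freqAnnulus ε₀) :=
  isClosed_Icc.preimage continuous_norm

/-- The annulus is compact. [folklore] -/
theorem isCompact_freqAnnulus (ε₀ : ℝ) : IsCompact (freqAnnulus ε₀) :=
  (isCompact_closedBall (0 : ℝ³) (1 + 2 * ε₀)).of_isClosed_subset (isClosed_freqAnnulus ε₀)
    fun ξ hξ => by simpa [mem_closedBall, dist_zero_right] using hξ.2

/-- Off the annulus, the Fourier transform of an annular profile vanishes. [cite: Tao2016AveragedNS, Def. 3.1] -/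
theorem HasAnnularFourierSupport.eq_zero_of_not_mem {ε₀ : ℝ} {ψ : 𝓢(ℝ³, ℝ³)}
    (hψ : HasAnnularFourierSupport ε₀ ψ) {ξ : ℝ³} (hξ : ξ ∉ freqAnnulus ε₀) :
    𝓕 (⇑(schwartzC ψ)) ξ = 0 := by
  rw [coe_schwartzC]
  refine hψ ξ ?_
  rw [mem_freqAnnulus, not_and_or, not_le, not_le] at hξ
  exact hξ

/-! ### A smooth finite partition of unity on the annulus subordinate to small balls -/

/-- **Smooth finite partition of unity on the annulus, subordinate to balls of radius `r`**: for
`r > 0` there are finitely many centres `c_a` in the annulus and smooth compactly supported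
`χ_a : ℝ³ → ℝ`, `χ_a` vanishing outside `B(c_a, r)`, with `∑_a χ_a = 1` on the annulus. [folklore] -/
theorem exists_annulus_partition (ε₀ : ℝ) {r : ℝ} (hr : 0 < r) :
    ∃ (ι : Type) (_ : Fintype ι) (c : ι → ℝ³) (χ : ι → ℝ³ → ℝ),
      (∀ a, c a ∈ freqAnnulus ε₀) ∧ (∀ a, ContDiff ℝ ∞ (χ a)) ∧ (∀ a, HasCompactSupport (χ a)) ∧
      (∀ a ξ, χ a ξ ≠ 0 → dist ξ (c a) < r) ∧ ∀ ξ ∈ freqAnnulus ε₀, ∑ a, χ a ξ = 1 := by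
  obtain ⟨t, hts, htfin, hcover⟩ := finite_cover_balls_of_compact (isCompact_freqAnnulus ε₀) hr
  haveI : Fintype t := htfin.fintype
  obtain ⟨f, hf⟩ := SmoothPartitionOfUnity.exists_isSubordinate 𝓘(ℝ, ℝ³)
    (isClosed_freqAnnulus ε₀) (fun i : t => ball (i : ℝ³) r) (fun _ => isOpen_ball) (by
      intro ξ hξ
      obtain ⟨x, hx, hξx⟩ := mem_iUnion₂.1 (hcover hξ)
      exact mem_iUnion.2 ⟨⟨x, hx⟩, hξx⟩)
  refine ⟨t, inferInstance, fun i => (i : ℝ³), fun i => f i, fun i => hts i.2, fun i => ?_,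
    fun i => ?_, fun i ξ hξ => ?_, fun ξ hξ => ?_⟩
  · exact (f i).contMDiff.contDiff
  · exact (isCompact_closedBall (i : ℝ³) r).of_isClosed_subset (isClosed_tsupport _)
      ((hf i).trans ball_subset_closedBall)
  · exact mem_ball.1 (hf i (subset_tsupport _ (Function.mem_support.2 hξ)))
  · have h := f.sum_eq_one hξ
    rwa [finsum_eq_sum_of_fintype] at h

/-! ### Fourier-multiplier pieces of a complex Schwartz field -/

/-- The piece `𝓕⁻¹(χ ψ̂)` of a complex Schwartz field cut out by a real frequency cutoff `χ` of
temperate growth (Mathlib's Fourier multiplier on Schwartz space). [cite: Tao2016AveragedNS, §3.2 p. 15] -/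
def freqPiece (χ : ℝ³ → ℝ) (ψ : 𝓢(ℝ³, ℂ³)) : 𝓢(ℝ³, ℂ³) :=
  SchwartzMap.fourierMultiplierCLM ℂ³ χ ψ

/-- **`𝓕(𝓕⁻¹(χ ψ̂)) = χ ψ̂`** pointwise. [folklore] -/
theorem fourier_freqPiece {χ : ℝ³ → ℝ} (hχ : χ.HasTemperateGrowth) (ψ : 𝓢(ℝ³, ℂ³)) (ξ : ℝ³) :
    𝓕 (⇑(freqPiece χ ψ)) ξ = χ ξ • 𝓕 (⇑ψ) ξ := by
  rw [← SchwartzMap.fourier_coe, ← SchwartzMap.fourier_coe, freqPiece,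
    SchwartzMap.fourierMultiplierCLM_apply, fourier_fourierInv_eq,
    SchwartzMap.smulLeftCLM_apply_apply hχ]

/-- A piece cut out by a cutoff vanishing outside `B(c, r)` has Fourier support in that ball. [cite: Tao2016AveragedNS, §3.2 p. 15] -/
theorem hasBallFourierSupport_freqPiece {χ : ℝ³ → ℝ} (hχ : χ.HasTemperateGrowth) {c : ℝ³} {r : ℝ}
    (hsupp : ∀ ξ, χ ξ ≠ 0 → dist ξ c < r) (ψ : 𝓢(ℝ³, ℂ³)) :
    HasBallFourierSupport c r (freqPiece χ ψ) := by
  intro ξ hξ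
  have h0 : χ ξ = 0 := by
    by_contra h
    exact lt_irrefl _ ((hsupp ξ h).trans hξ)
  rw [fourier_freqPiece hχ, h0, zero_smul]

/-- **The pieces of a finite partition of unity on the Fourier support sum to the field**: if
`∑_a χ_a = 1` wherever `ψ̂ ≠ 0`, then `∑_a 𝓕⁻¹(χ_a ψ̂) = ψ`. [cite: Tao2016AveragedNS, §3.2 p. 15] -/
theorem sum_freqPiece_eq {ι : Type*} (s : Finset ι) {χ : ι → ℝ³ → ℝ}
    (hχ : ∀ a ∈ s, (χ a).HasTemperateGrowth) (ψ : 𝓢(ℝ³, ℂ³))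
    (hsum : ∀ ξ, 𝓕 (⇑ψ) ξ ≠ 0 → ∑ a ∈ s, χ a ξ = 1) :
    ∑ a ∈ s, freqPiece (χ a) ψ = ψ := by
  have hS : (fun ξ => ∑ a ∈ s, χ a ξ).HasTemperateGrowth := Function.HasTemperateGrowth.sum hχ
  have h1 : ∑ a ∈ s, freqPiece (χ a) ψ =
      SchwartzMap.fourierMultiplierCLM ℂ³ (fun ξ => ∑ a ∈ s, χ a ξ) ψ := by
    rw [SchwartzMap.fourierMultiplierCLM_sum ℂ³ hχ, _root_.sum_apply]
    rfl
  have h2 : SchwartzMap.smulLeftCLM ℂ³ (fun ξ => ∑ a ∈ s, χ a ξ) (𝓕 ψ) = 𝓕 ψ := by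
    ext ξ
    rw [SchwartzMap.smulLeftCLM_apply_apply hS]
    by_cases h : 𝓕 (⇑ψ) ξ = 0
    · rw [SchwartzMap.fourier_coe, h, smul_zero]
    · rw [hsum ξ h, one_smul]
  rw [h1, SchwartzMap.fourierMultiplierCLM_apply, h2, fourierInv_fourier_eq]

/-! ### The decomposition of an annular profile -/

/-- **Decomposition of an annular real profile into ball-supported complex pieces** (Tao §3.2:
"by decomposing the `ψⱼ` … into finitely many (complex-valued) pieces … with Fourier transform
supported on the ball `B(ξⱼ⁰, ε₀³)` for some non-zero `ξⱼ⁰` with magnitude comparable to `1`"):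
for `r > 0` there is one finite family of centres `c_a` in the annulus `{1-2ε₀ ≤ |ξ| ≤ 1+2ε₀}`
and, for every real Schwartz `ψ` with Fourier support in the annulus, complex Schwartz fields
`ψ_a` with `ψ̂_a` supported in `B(c_a, r)` and `∑_a ψ_a = ψ` (complexified). The family of centres
and the cutting operators depend only on `ε₀` and `r`. [cite: Tao2016AveragedNS, §3.2 p. 15] -/
theorem exists_ball_pieces (ε₀ : ℝ) {r : ℝ} (hr : 0 < r) :
    ∃ (ι : Type) (_ : Fintype ι) (c : ι → ℝ³) (P : ι → 𝓢(ℝ³, ℂ³) → 𝓢(ℝ³, ℂ³)),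
      (∀ a, c a ∈ freqAnnulus ε₀) ∧
      (∀ a (ψ : 𝓢(ℝ³, ℂ³)), (∀ ξ, ξ ∉ freqAnnulus ε₀ → 𝓕 (⇑ψ) ξ = 0) →
        HasBallFourierSupport (c a) r (P a ψ)) ∧
      ∀ ψ : 𝓢(ℝ³, ℂ³), (∀ ξ, ξ ∉ freqAnnulus ε₀ → 𝓕 (⇑ψ) ξ = 0) → ∑ a, P a ψ = ψ := by
  obtain ⟨ι, _, c, χ, hc, hsmooth, hcpt, hsupp, hsum⟩ := exists_annulus_partition ε₀ hr
  have hχ : ∀ a, (χ a).HasTemperateGrowth := fun a => (hcpt a).hasTemperateGrowth (hsmooth a)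
  refine ⟨ι, inferInstance, c, fun a ψ => freqPiece (χ a) ψ, hc, fun a ψ _ => ?_, fun ψ hψ => ?_⟩
  · exact hasBallFourierSupport_freqPiece (hχ a) (hsupp a) ψ
  · refine sum_freqPiece_eq Finset.univ (fun a _ => hχ a) ψ fun ξ hξ => hsum ξ ?_
    by_contra h
    exact hξ (hψ ξ h)

/-- The decomposition applied to a real annular profile of Definition 3.1 (complexified by
`schwartzC`). [cite: Tao2016AveragedNS, §3.2 p. 15] -/
theorem HasAnnularFourierSupport.fourier_schwartzC_eq_zero {ε₀ : ℝ} {ψ : 𝓢(ℝ³, ℝ³)}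
    (hψ : HasAnnularFourierSupport ε₀ ψ) : ∀ ξ, ξ ∉ freqAnnulus ε₀ → 𝓕 (⇑(schwartzC ψ)) ξ = 0 :=
  fun _ hξ => hψ.eq_zero_of_not_mem hξ

end Literature.Analysis.FluidPDE.Tao2016
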